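import Literature.RingTheory.MvPowerSeries.MonoidPowerSeriesGenerators
import Literature.RingTheory.MvPowerSeries.MaximalIdealPow
import HarnessLib

/-!
# Evaluating `R⟦P⟧` in a local ring: ring homomorphisms out of the completed monoid algebra

`Literature/RingTheory/MvPowerSeries/MonoidPowerSeriesLift.lean`. K. Kato, *Toric singularities*,
Amer. J. Math. 116 (1994), proof of (3.2): the chart `φ : P → 𝒪_{X,x}` "is extended to" a ring
homomorphism `R[[P]] → 𝒪̂_{X,x}`. With `R⟦P⟧ = R⟦X₁,…,X_m⟧/ker` (`MonoidPowerSeriesGenerators.lean`,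
`Xᵢ ↦ x^{gᵢ}`), this is PROVED here as: a ring homomorphism `Θ : R⟦X₁, …, X_m⟧ → C` into a
Noetherian local ring `C`, sending the variables into `𝔪_C`, whose value on `X^d` depends only on
`∑ dᵢ gᵢ ∈ P`, kills `ker (R⟦X⟧ → R⟦P⟧)` (`map_eq_zero_of_substGenerators_eq_zero`; Krull's
intersection theorem: split `F` at total degree `nG`, regroup the low part along the fibres of
`d ↦ ∑ dᵢ gᵢ`, bound the high part by `map_mem_pow_of_coeff_eq_zero`), hence factors through
`R⟦P⟧` (`lift`, `lift_comp_apply`, `lift_monomial`, `lift_C`).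
References: [Kato1994] K. Kato, Toric singularities, Amer. J. Math. 116 (1994), §3.
-/

noncomputable section

open MvPowerSeries IsLocalRing

namespace Literature.RingTheory.MvPowerSeries

namespace monoidPowerSeries

universe u v w w'

variable {σ : Type u} {R : Type v} [CommRing R]

section Jets

variable {ι : Type w}

/-- For finite `ι`, the exponents of degree `≤ N` form a finite set. [cite: Kato1994, §3] -/
theorem finite_degree_le [Finite ι] (N : ℕ) : {d : ι →₀ ℕ | d.degree ≤ N}.Finite := by
  classical
  haveI := Fintype.ofFinite ι
  have hsub : {p : ι →₀ ℕ | p.degree ≤ N} ⊆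
      Set.range (fun v : ι → Fin (N + 1) =>
        Finsupp.equivFunOnFinite.symm (fun i => (v i : ℕ))) := by
    intro p hp
    refine ⟨fun i => ⟨p i, Nat.lt_succ_of_le ((Finsupp.le_degree i p).trans hp)⟩, ?_⟩
    ext i
    simp
  exact (Set.finite_range _).subset hsub

/-- A series with no terms of degree `< N` is a FINITE combination `∑_{|e| = N} X^e · G_e`
(adapted from the field case `…MvPowerSeries.Jets.exists_eq_sum_monomial_mul`). [cite: Kato1994, §3] -/
theorem exists_eq_sum_monomial_mul [Finite ι] (N : ℕ) (F : MvPowerSeries ι R)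
    (hF : ∀ e : ι →₀ ℕ, e.degree < N → MvPowerSeries.coeff e F = 0) :
    ∃ (S : Finset (ι →₀ ℕ)) (G : (ι →₀ ℕ) → MvPowerSeries ι R),
      (∀ e ∈ S, e.degree = N) ∧ F = ∑ e ∈ S, MvPowerSeries.monomial e (1 : R) * G e := by
  classical
  have hch : ∀ d : ι →₀ ℕ, ∃ e : ι →₀ ℕ, N ≤ d.degree → e ≤ d ∧ e.degree = N := by
    intro d
    by_cases hd : N ≤ d.degree
    · obtain ⟨e, he⟩ := Literature.RingTheory.MvPowerSeries.Jets.exists_le_degree_eq N d hd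
      exact ⟨e, fun _ => he⟩
    · exact ⟨0, fun h => (hd h).elim⟩
  choose pref hpref using hch
  let S : Finset (ι →₀ ℕ) := (finite_degree_le (ι := ι) N).toFinset.filter fun e => e.degree = N
  have hS : ∀ e, e ∈ S ↔ e.degree = N := by
    intro e
    simp only [S, Finset.mem_filter, Set.Finite.mem_toFinset, Set.mem_setOf_eq]
    exact ⟨fun h => h.2, fun h => ⟨h.le, h⟩⟩
  let G : (ι →₀ ℕ) → MvPowerSeries ι R := fun e d' =>
    if pref (e + d') = e then MvPowerSeries.coeff (e + d') F else 0
  refine ⟨S, G, fun e he => (hS e).1 he, ?_⟩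
  ext d
  rw [map_sum]
  simp only [MvPowerSeries.coeff_monomial_mul, one_mul]
  have hG : ∀ e d' : ι →₀ ℕ, MvPowerSeries.coeff d' (G e) =
      if pref (e + d') = e then MvPowerSeries.coeff (e + d') F else 0 := fun _ _ => rfl
  by_cases hd : N ≤ d.degree
  · obtain ⟨hle, hdeg⟩ := hpref d hd
    rw [Finset.sum_eq_single (pref d)]
    · rw [if_pos hle, hG, add_tsub_cancel_of_le hle, if_pos rfl]
    · intro e _ hne
      split_ifs with hed
      · rw [hG, add_tsub_cancel_of_le hed, if_neg (Ne.symm hne)]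
      · rfl
    · intro hnot
      exact (hnot ((hS _).2 hdeg)).elim
  · push Not at hd
    rw [hF d hd, eq_comm]
    refine Finset.sum_eq_zero fun e he => ?_
    rw [if_neg]
    intro hed
    have := Finsupp.degree_mono hed
    rw [(hS e).1 he] at this
    omega

/-- The image of a monomial `X^e` under a ring homomorphism sending the variables into an
ideal `I` lies in `I^{|e|}`. [cite: Kato1994, §3] -/
theorem map_monomial_one_mem_pow {C : Type w'} [CommRing C] (Θ : MvPowerSeries ι R →+* C)
    (I : Ideal C) (hΘX : ∀ i, Θ (MvPowerSeries.X i) ∈ I) (e : ι →₀ ℕ) :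
    Θ (MvPowerSeries.monomial e (1 : R)) ∈ I ^ e.degree := by
  classical
  induction e using Finsupp.induction with
  | zero =>
    rw [MvPowerSeries.monomial_zero_one, map_one, map_zero, pow_zero, Ideal.one_eq_top]
    exact Submodule.mem_top
  | single_add i n e _ _ ih =>
    have hmul : MvPowerSeries.monomial (Finsupp.single i n + e) (1 : R) =
        MvPowerSeries.X i ^ n * MvPowerSeries.monomial e 1 := by
      rw [MvPowerSeries.X_pow_eq, MvPowerSeries.monomial_mul_monomial, one_mul]
    rw [hmul, map_mul, map_pow, map_add, Finsupp.degree_single, pow_add]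
    exact Ideal.mul_mem_mul (Ideal.pow_mem_pow (hΘX i) n) ih

/-- **Automatic continuity**: a ring homomorphism `Θ : R⟦Xᵢ : i ∈ ι⟧ → C` (`ι` finite) sending
every variable into an ideal `I` sends every series with no terms of degree `< N` into `I^N`.
[cite: Kato1994, §3] -/
theorem map_mem_pow_of_coeff_eq_zero [Finite ι] {C : Type w'} [CommRing C]
    (Θ : MvPowerSeries ι R →+* C) (I : Ideal C) (hΘX : ∀ i, Θ (MvPowerSeries.X i) ∈ I)
    {N : ℕ} {F : MvPowerSeries ι R}
    (hF : ∀ e : ι →₀ ℕ, e.degree < N → MvPowerSeries.coeff e F = 0) :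
    Θ F ∈ I ^ N := by
  classical
  obtain ⟨S, G, hS, rfl⟩ := exists_eq_sum_monomial_mul N F hF
  rw [map_sum]
  refine Ideal.sum_mem _ fun e he => ?_
  rw [map_mul]
  refine Ideal.mul_mem_right _ _ ?_
  rw [← hS e he]
  exact map_monomial_one_mem_pow Θ I hΘX e

open Classical in
/-- The part of a series of total degree `< T` (as a series). [cite: Kato1994, §3] -/
def lowPart (T : ℕ) (F : MvPowerSeries ι R) : MvPowerSeries ι R :=
  fun d => if d.degree < T then MvPowerSeries.coeff d F else 0

open Classical in
/-- Coefficients of the low part. [cite: Kato1994, §3] -/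
theorem coeff_lowPart (T : ℕ) (F : MvPowerSeries ι R) (d : ι →₀ ℕ) :
    MvPowerSeries.coeff d (lowPart (R := R) T F) =
      if d.degree < T then MvPowerSeries.coeff d F else 0 :=
  rfl

/-- The high part `F - lowPart T F` has no terms of degree `< T`. [cite: Kato1994, §3] -/
theorem coeff_sub_lowPart_of_lt (T : ℕ) (F : MvPowerSeries ι R) {d : ι →₀ ℕ}
    (hd : d.degree < T) : MvPowerSeries.coeff d (F - lowPart (R := R) T F) = 0 := by
  rw [map_sub, coeff_lowPart, if_pos hd, sub_self]

/-- The low part is the finite sum of its monomials. [cite: Kato1994, §3] -/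
theorem lowPart_eq_sum [Finite ι] (T : ℕ) (F : MvPowerSeries ι R) :
    lowPart (R := R) T F =
      ∑ d ∈ ((finite_degree_le (ι := ι) T).toFinset.filter fun d => d.degree < T),
        MvPowerSeries.monomial d (MvPowerSeries.coeff d F) := by
  classical
  ext e
  rw [coeff_lowPart, map_sum]
  simp only [MvPowerSeries.coeff_monomial]
  by_cases he : e.degree < T
  · rw [if_pos he, Finset.sum_eq_single e]
    · rw [if_pos rfl]
    · intro d _ hde
      rw [if_neg (Ne.symm hde)]
    · intro hnot
      exfalso
      apply hnot
      simp only [Finset.mem_filter, Set.Finite.mem_toFinset, Set.mem_setOf_eq]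
      exact ⟨he.le, he⟩
  · rw [if_neg he]
    symm
    refine Finset.sum_eq_zero fun d hd => ?_
    rw [if_neg]
    rintro rfl
    simp only [Finset.mem_filter, Set.Finite.mem_toFinset, Set.mem_setOf_eq] at hd
    exact he hd.2

end Jets

/-! ### Factoring a homomorphism through `R⟦P⟧` -/

section Lift

variable {ι : Type w} [Finite ι] (g : ι → (σ →₀ ℕ))

omit [Finite ι] in
/-- The degree of `∑ dᵢ gᵢ` dominates the degree of `d` (every `gᵢ ≠ 0` has degree `≥ 1`).
[cite: Kato1994, §3] -/
theorem degree_le_degree_expSum (hg0 : ∀ i, g i ≠ 0) (d : ι →₀ ℕ) :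
    d.degree ≤ (expSum g d).degree := by
  classical
  induction d using Finsupp.induction with
  | zero => rw [expSum_zero, map_zero, map_zero]
  | single_add i n e _ _ ih =>
    rw [expSum_add, expSum_single, map_add, map_add, Finsupp.degree_single, map_nsmul,
      smul_eq_mul]
    have h1 : 1 ≤ (g i).degree :=
      Nat.one_le_iff_ne_zero.2 fun h => hg0 i ((Finsupp.degree_eq_zero_iff _).1 h)
    nlinarith

omit [Finite ι] in
/-- The degree of `∑ dᵢ gᵢ` is at most `G · |d|` if every generator has degree `≤ G`.
[cite: Kato1994, §3] -/
theorem degree_expSum_le (G : ℕ) (hG : ∀ i, (g i).degree ≤ G) (d : ι →₀ ℕ) :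
    (expSum g d).degree ≤ G * d.degree := by
  classical
  induction d using Finsupp.induction with
  | zero => rw [expSum_zero, map_zero, map_zero, mul_zero]
  | single_add i n e _ _ ih =>
    rw [expSum_add, expSum_single, map_add, map_add, Finsupp.degree_single, map_nsmul,
      smul_eq_mul, mul_add]
    have := hG i
    nlinarith

/-- The fibre of `d ↦ ∑ dᵢ gᵢ` over an exponent `q` is finite (`gᵢ ≠ 0`). [cite: Kato1994, §3] -/
theorem finite_fibre_expSum (hg0 : ∀ i, g i ≠ 0) (q : σ →₀ ℕ) : {d : ι →₀ ℕ | expSum g d = q}.Finite :=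
  (finite_degree_le (ι := ι) q.degree).subset fun d hd =>
    (degree_le_degree_expSum g hg0 d).trans (le_of_eq (congrArg Finsupp.degree hd))

/-- The coefficient of `x^q` in `F(x^{g₁}, …, x^{g_m})` as a FINITE sum over the fibre of `q`.
[cite: Kato1994, §3] -/
theorem coeff_substGenerators (hg0 : ∀ i, g i ≠ 0) (F : MvPowerSeries ι R) (q : σ →₀ ℕ) :
    MvPowerSeries.coeff q (substGenerators (R := R) g hg0 F) =
      ∑ d ∈ (finite_fibre_expSum g hg0 q).toFinset, MvPowerSeries.coeff d F := by
  classical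
  rw [substGenerators_apply, coeff_subst_monomial g hg0]
  rw [finsum_eq_sum_of_support_subset _ (s := (finite_fibre_expSum g hg0 q).toFinset)]
  · refine Finset.sum_congr rfl fun d hd => ?_
    rw [Set.Finite.mem_toFinset, Set.mem_setOf_eq] at hd
    rw [if_pos hd]
  · intro d hd
    rw [Function.mem_support] at hd
    rw [Finset.mem_coe, Set.Finite.mem_toFinset, Set.mem_setOf_eq]
    by_contra h
    exact hd (if_neg h)

omit [Finite ι] in
/-- `monomial d r = C r * monomial d 1`. [cite: Kato1994, §3] -/
theorem monomial_eq_C_mul_monomial_one (d : ι →₀ ℕ) (r : R) :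
    MvPowerSeries.monomial d r = MvPowerSeries.C r * MvPowerSeries.monomial d (1 : R) := by
  classical
  ext e
  rw [MvPowerSeries.coeff_C_mul, MvPowerSeries.coeff_monomial, MvPowerSeries.coeff_monomial]
  split_ifs <;> simp

variable {C : Type w'} [CommRing C] [IsLocalRing C] [IsNoetherianRing C]

/-- **A homomorphism `R⟦X₁, …, X_m⟧ → C` defined by a monoid homomorphism on `P = ⟨gᵢ⟩` kills
the kernel of `R⟦X⟧ → R⟦P⟧`** (`C` Noetherian local, variables sent into `𝔪_C`, and the value
on `X^d` depending only on `∑ dᵢ gᵢ`): Kato's "the chart `P → 𝒪_{X,x}` is extended to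
`R[[P]] → 𝒪̂_{X,x}`". [cite: Kato1994, §3 (proof of (3.2))] -/
theorem map_eq_zero_of_substGenerators_eq_zero (hg0 : ∀ i, g i ≠ 0) (Θ : MvPowerSeries ι R →+* C)
    (hΘX : ∀ i, Θ (MvPowerSeries.X i) ∈ maximalIdeal C)
    (hΘmon : ∀ d d' : ι →₀ ℕ, expSum g d = expSum g d' →
      Θ (MvPowerSeries.monomial d (1 : R)) = Θ (MvPowerSeries.monomial d' 1))
    {F : MvPowerSeries ι R} (hF : substGenerators (R := R) g hg0 F = 0) : Θ F = 0 := by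
  classical
  haveI := Fintype.ofFinite ι
  -- a common bound `G ≥ 1` for the degrees of the generators
  set G : ℕ := Finset.univ.sup (fun i => (g i).degree) + 1 with hGdef
  have hG : ∀ i, (g i).degree ≤ G := fun i =>
    (Finset.le_sup (f := fun i => (g i).degree) (Finset.mem_univ i)).trans (Nat.le_succ _)
  have hG1 : 1 ≤ G := Nat.le_add_left 1 _
  -- the fibre sums of the coefficients of `F` vanish
  have hfib : ∀ q : σ →₀ ℕ, ∑ d ∈ (finite_fibre_expSum g hg0 q).toFinset,
      MvPowerSeries.coeff d F = 0 := by
    intro q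
    rw [← coeff_substGenerators g hg0 F q, hF, map_zero]
  -- Krull: it suffices that `Θ F ∈ 𝔪^n` for all `n`
  have hmem : ∀ n : ℕ, Θ F ∈ maximalIdeal C ^ n := by
    intro n
    set T := n * G with hT
    have hnT : n ≤ T := by rw [hT]; exact Nat.le_mul_of_pos_right n hG1
    have hsplit : F = lowPart (R := R) T F + (F - lowPart T F) := by abel
    rw [hsplit, map_add]
    refine Ideal.add_mem _ ?_ ?_
    · -- the low part: split the index set according to the degree of `expSum`
      rw [lowPart_eq_sum, map_sum, ← Finset.sum_filter_add_sum_filter_not _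
        (fun d : ι →₀ ℕ => (expSum g d).degree < T)]
      refine Ideal.add_mem _ ?_ (Ideal.sum_mem _ fun d hd => ?_)
      · -- fibres of small degree are complete: their contributions vanish
        set D₁ := ((finite_degree_le (ι := ι) T).toFinset.filter fun d => d.degree < T).filter
          (fun d : ι →₀ ℕ => (expSum g d).degree < T) with hD₁
        have hzero : ∑ d ∈ D₁, Θ (MvPowerSeries.monomial d (MvPowerSeries.coeff d F)) = 0 := by
          rw [← Finset.sum_image' (s := D₁) (g := expSum g) (f := fun _ => (0 : C))
            (h := fun d => Θ (MvPowerSeries.monomial d (MvPowerSeries.coeff d F)))]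
          · exact Finset.sum_const_zero
          intro i hi
          have hqi : (expSum g i).degree < T := (Finset.mem_filter.1 hi).2
          -- the fibre of `expSum g i` inside `D₁` is the full fibre
          have hfibre : D₁.filter (fun j => expSum g j = expSum g i) =
              (finite_fibre_expSum g hg0 (expSum g i)).toFinset := by
            ext j
            simp only [hD₁, Finset.mem_filter, Set.Finite.mem_toFinset, Set.mem_setOf_eq]
            constructor
            · rintro ⟨-, hj⟩; exact hj
            · intro hj
              have hdj : j.degree < T :=
                (degree_le_degree_expSum g hg0 j).trans_lt (hj.symm ▸ hqi)
              exact ⟨⟨⟨hdj.le, hdj⟩, hj.symm ▸ hqi⟩, hj⟩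
          symm
          calc ∑ j ∈ D₁ with expSum g j = expSum g i,
                Θ (MvPowerSeries.monomial j (MvPowerSeries.coeff j F))
              = ∑ j ∈ D₁ with expSum g j = expSum g i,
                  Θ (MvPowerSeries.C (MvPowerSeries.coeff j F)) *
                    Θ (MvPowerSeries.monomial i (1 : R)) := by
                refine Finset.sum_congr rfl fun j hj => ?_
                rw [monomial_eq_C_mul_monomial_one, map_mul,
                  hΘmon j i (Finset.mem_filter.1 hj).2]
            _ = Θ (MvPowerSeries.C (∑ j ∈ D₁ with expSum g j = expSum g i,
                  MvPowerSeries.coeff j F)) * Θ (MvPowerSeries.monomial i (1 : R)) := by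
                rw [← Finset.sum_mul, map_sum, map_sum]
            _ = 0 := by rw [hfibre, hfib, map_zero, map_zero, zero_mul]
        rw [hzero]
        exact Ideal.zero_mem _
      · -- `|expSum d| ≥ T = nG` forces `|d| ≥ n`, so `Θ(x^d) ∈ 𝔪^n`
        have hq : T ≤ (expSum g d).degree := not_lt.1 (Finset.mem_filter.1 hd).2
        have hdeg : n ≤ d.degree := by
          have h1 : n * G ≤ G * d.degree := hq.trans (degree_expSum_le g G hG d)
          rw [mul_comm] at h1
          exact Nat.le_of_mul_le_mul_left h1 hG1
        rw [monomial_eq_C_mul_monomial_one, map_mul]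
        exact Ideal.mul_mem_left _ _
          (Ideal.pow_le_pow_right hdeg (map_monomial_one_mem_pow Θ _ hΘX d))
    · -- the high part lies in `𝔪^T ⊆ 𝔪^n`
      exact Ideal.pow_le_pow_right hnT
        (map_mem_pow_of_coeff_eq_zero Θ _ hΘX (fun e he => coeff_sub_lowPart_of_lt T F he))
  have hinf : Θ F ∈ ⨅ n : ℕ, maximalIdeal C ^ n := Ideal.mem_iInf.2 hmem
  rwa [Ideal.iInf_pow_eq_bot_of_isLocalRing _ (maximalIdeal.isMaximal C).ne_top,
    Ideal.mem_bot] at hinf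

/-- The kernel of `R⟦X⟧ → R⟦P⟧` is contained in the kernel of such a `Θ`.
[cite: Kato1994, §3 (proof of (3.2))] -/
theorem ker_substGeneratorsOnto_le_ker (hg0 : ∀ i, g i ≠ 0) {P : AddSubmonoid (σ →₀ ℕ)}
    (hP : AddSubmonoid.closure (Set.range g) = P) (Θ : MvPowerSeries ι R →+* C)
    (hΘX : ∀ i, Θ (MvPowerSeries.X i) ∈ maximalIdeal C)
    (hΘmon : ∀ d d' : ι →₀ ℕ, expSum g d = expSum g d' →
      Θ (MvPowerSeries.monomial d (1 : R)) = Θ (MvPowerSeries.monomial d' 1)) :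
    RingHom.ker (substGeneratorsOnto (R := R) g hg0 hP).toRingHom ≤ RingHom.ker Θ := by
  intro F hF
  rw [RingHom.mem_ker] at hF ⊢
  refine map_eq_zero_of_substGenerators_eq_zero g hg0 Θ hΘX hΘmon ?_
  have := congrArg (fun f : monoidPowerSeries R P => (f : MvPowerSeries σ R)) hF
  simpa [coe_substGeneratorsOnto] using this

/-- **The induced homomorphism `R⟦P⟧ → C`** ("extension of the chart to `R[[P]]`", Kato (3.2)):
the factorization of `Θ` through `R⟦X⟧ ↠ R⟦P⟧`. [cite: Kato1994, §3 (proof of (3.2))] -/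
def lift (hg0 : ∀ i, g i ≠ 0) {P : AddSubmonoid (σ →₀ ℕ)}
    (hP : AddSubmonoid.closure (Set.range g) = P)
    (Θ : MvPowerSeries ι R →+* C) (hΘX : ∀ i, Θ (MvPowerSeries.X i) ∈ maximalIdeal C)
    (hΘmon : ∀ d d' : ι →₀ ℕ, expSum g d = expSum g d' →
      Θ (MvPowerSeries.monomial d (1 : R)) = Θ (MvPowerSeries.monomial d' 1)) :
    monoidPowerSeries R P →+* C :=
  (RingHom.liftOfSurjective (substGeneratorsOnto (R := R) g hg0 hP).toRingHom
    (substGeneratorsOnto_surjective g hg0 hP))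
    ⟨Θ, ker_substGeneratorsOnto_le_ker g hg0 hP Θ hΘX hΘmon⟩

/-- The defining property of the lift: `lift ∘ (R⟦X⟧ ↠ R⟦P⟧) = Θ`.
[cite: Kato1994, §3 (proof of (3.2))] -/
theorem lift_comp_apply (hg0 : ∀ i, g i ≠ 0) {P : AddSubmonoid (σ →₀ ℕ)}
    (hP : AddSubmonoid.closure (Set.range g) = P)
    (Θ : MvPowerSeries ι R →+* C) (hΘX : ∀ i, Θ (MvPowerSeries.X i) ∈ maximalIdeal C)
    (hΘmon : ∀ d d' : ι →₀ ℕ, expSum g d = expSum g d' →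
      Θ (MvPowerSeries.monomial d (1 : R)) = Θ (MvPowerSeries.monomial d' 1))
    (F : MvPowerSeries ι R) :
    lift g hg0 hP Θ hΘX hΘmon (substGeneratorsOnto (R := R) g hg0 hP F) = Θ F :=
  RingHom.liftOfRightInverse_comp_apply _ _ _ _ F

/-- The lift on a monomial `x^{expSum g d}` of `R⟦P⟧` is `Θ (X^d)`.
[cite: Kato1994, §3 (proof of (3.2))] -/
theorem lift_monomial (hg0 : ∀ i, g i ≠ 0) {P : AddSubmonoid (σ →₀ ℕ)}
    (hP : AddSubmonoid.closure (Set.range g) = P)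
    (Θ : MvPowerSeries ι R →+* C) (hΘX : ∀ i, Θ (MvPowerSeries.X i) ∈ maximalIdeal C)
    (hΘmon : ∀ d d' : ι →₀ ℕ, expSum g d = expSum g d' →
      Θ (MvPowerSeries.monomial d (1 : R)) = Θ (MvPowerSeries.monomial d' 1))
    (d : ι →₀ ℕ) :
    lift g hg0 hP Θ hΘX hΘmon ⟨MvPowerSeries.monomial (expSum g d) (1 : R),
      monomial_mem (hP ▸ expSum_mem_closure g d) 1⟩ = Θ (MvPowerSeries.monomial d 1) := by
  have h : substGeneratorsOnto (R := R) g hg0 hP (MvPowerSeries.monomial d 1) =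
      ⟨MvPowerSeries.monomial (expSum g d) (1 : R), monomial_mem (hP ▸ expSum_mem_closure g d) 1⟩ := by
    refine Subtype.ext ?_
    rw [coe_substGeneratorsOnto, substGenerators_apply,
      MvPowerSeries.subst_monomial (hasSubst_monomial g hg0), map_one, one_mul, prod_pow_monomial]
  rw [← h, lift_comp_apply]

/-- The lift on constants. [cite: Kato1994, §3 (proof of (3.2))] -/
theorem lift_C (hg0 : ∀ i, g i ≠ 0) {P : AddSubmonoid (σ →₀ ℕ)}
    (hP : AddSubmonoid.closure (Set.range g) = P)
    (Θ : MvPowerSeries ι R →+* C) (hΘX : ∀ i, Θ (MvPowerSeries.X i) ∈ maximalIdeal C)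
    (hΘmon : ∀ d d' : ι →₀ ℕ, expSum g d = expSum g d' →
      Θ (MvPowerSeries.monomial d (1 : R)) = Θ (MvPowerSeries.monomial d' 1))
    (r : R) :
    lift g hg0 hP Θ hΘX hΘmon ⟨MvPowerSeries.C r, C_mem r⟩ = Θ (MvPowerSeries.C r) := by
  have h : substGeneratorsOnto (R := R) g hg0 hP (MvPowerSeries.C r) = ⟨MvPowerSeries.C r, C_mem r⟩ := by
    refine Subtype.ext ?_
    rw [coe_substGeneratorsOnto, substGenerators_apply, MvPowerSeries.subst_C]
  rw [← h, lift_comp_apply]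

end Lift

end monoidPowerSeries

end Literature.RingTheory.MvPowerSeries
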